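import Literature.AlgebraicGeometry.ModuliOfAbelianVarieties.SiegelFamilyShimuraLocusGenericPointsDense
import Literature.AlgebraicGeometry.ModuliOfAbelianVarieties.SiegelFamilyShimuraLocusParametrization
import HarnessLib

/-!
# Shimura's Theorem 2 in Baire-category form ON the locus: the generic points of `𝔥_g ∩ 𝔜_j` are
# RESIDUAL (comeagre) in `𝔥_g ∩ 𝔜_j` — «`X_f` is a closed subset of `𝔜`, which contains no non-empty
# open subset of `𝔜` … Since `S′` is a countable set, `𝔜` cannot be covered by `∪_{f ∈ S′} X_f`»
# (Shimura 1972, §3 Prop. 11 and Thm. 2)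

Topic `Literature/AlgebraicGeometry/ModuliOfAbelianVarieties` (the Siegel-family files, namespace
`Literature.AlgebraicGeometry.ModuliOfAbelianVarieties.SiegelModuli`).  Lane `lit-hodgefound`
(Track 2 foundations library), prover seat p15 generation 50, row g50-#1, on top of g49-#7
(`locus_subset_closure_generic`: the generic points are DENSE in `𝔥_g ∩ 𝔜_j`), g49-#6 (`locus_nonempty`),
g49-#1 (`transpose_mul_self_eq_one_of_locusJ`), g48-#1 (Prop. 10: `exists_isPolarizedIso_blockDiag`),
g48-#5 (Prop. 12: `isIsomorphic_conj_and_isEmpty_realStructure_of_blockRel`) and g48-#3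
(`exists_blocks_rel_of_mulVec_latticeJ`: a holomorphic `ρ(M)`, `M = (α β; γ δ)`, forces the period
relation `(Zβ + δ)Z = Zα + γ`).  g49-#7 rendered «`𝔜` cannot be covered by `∪ X_f`» as DENSITY of the
generic points; Shimura's argument is a Baire-category argument and gives more: the generic points form a
RESIDUAL subset of the Baire space `𝔥_g ∩ 𝔜_j` (a countable intersection of open dense subsets), so that
no countable union of closed nowhere dense subsets of `𝔜_j` — Shimura's `X_f` — can cover them.  THIS FILE
proves exactly that, with Shimura's `X_f = {z ∈ 𝔜 : f(φ(z)) = 0}` (one for each rational polynomial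
relation `f` among the moduli) replaced by the tree's `X_M = {Z ∈ 𝔥_g ∩ 𝔜_j : ρ(M) ∈ End(X_Z)}` (one for
each non-scalar integral `2g × 2g` matrix `M`).  THEOREMS ONLY: no definition, no instance, no notation,
no named fact (net Literature debt `0`), no `sorry`.

## Source, VERBATIM

G. Shimura, *On the field of rationality for an abelian variety*, Nagoya Math. J. **45** (1972) 167–178,
held `paper:doi-10-1017-s0027763000014720`, §3 «The even dimensional case», pp. 174–177:
«**PROPOSITION 10.** … let `𝔜` be the set of all `z ∈ 𝔖_n` such that `jz = −z^ρ j`.  Then, for every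
`z ∈ 𝔜`, there is an isomorphism `λ` of `P_z` onto `P_z^ρ` such that `λ^ρ ∘ λ = −1`.»
«**PROPOSITION 11.** The set `𝔜` of Prop. 10 is non-empty.  Moreover, let `g` be a holomorphic function
defined on a connected domain `D` contained in `𝔖_n`.  If `g = 0` on a non-empty open subset of `D ∩ 𝔜`,
then `g` is identically `0` on `D`.»
«**PROPOSITION 12.** If `P_z`, with `z ∈ 𝔜`, has no automorphisms other than `±1`, then `P_z` has no
model rational over its field of moduli.»
«**THEOREM 2.** Let `P` be a generic polarized abelian variety of even dimension.  If the polarization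
satisfies the condition (5), then `P` has no model rational over its field of moduli.  Proof. … to prove
our theorem, it is sufficient to find a generic `P_z` with `z` in `𝔜`.  This can be done as follows.  Let
`S` be the set of all homogeneous polynomials with rational coefficients viewed as functions in the
projective space in which `V` is situated.  Let `S′` be the subset of `S` consisting of all the `f ∈ S`
such that `f∘φ` is not identically `0`.  Put, for each `f ∈ S′`, `X_f = {z ∈ 𝔜 : f(φ(z)) = 0}`.  Then `X_f`
is a closed subset of `𝔜`, which contains no non-empty open subset of `𝔜` by Prop. 11.  Since `S′` is a
countable set, `𝔜` cannot be covered by `∪_{f ∈ S′} X_f`.  Therefore `𝔜` has a point `z` for which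
`f(φ(z)) ≠ 0` for all `f ∈ S′`.  Then `φ(z)` is generic on `V` over `ℚ`, q.e.d.»

## The tree's rendering (principal type, `X_Z = ℂ^g/(Z, 1)ℤ^{2g}`, `𝔜_j = {Z ∈ 𝔥_g : jZ = −Z̄j}`)

As in g48/g49, Shimura's «generic» (generic point of the moduli variety `V/ℚ`) is rendered by the
torus-level property it is used for, `End(X_Z) = ℤ` (every integral `M` with `M_ℝ J_Z = J_Z M_ℝ` is
scalar), and «no model over the field of moduli although `P_z ≅ P_z^ρ`» by: `(X_Z, E_Z) ≅ (X_{−Z̄}, E_{−Z̄})`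
as principally polarized tori, `X_Z ≅` every conjugate presentation, `IsEmpty (RealStructure X_Z)`.

* **§1 `End(X_Z)` in blocks, both ways.**  `ρ(α β; γ δ) ∈ End(X_Z)` iff `(Zβ + δ)Z = Zα + γ`
  (`mulVec_latticeJ_comm_of_blocks_rel`, `mulVec_latticeJ_comm_iff_toBlocks_rel`; g48-#3 had «only if»).
* **§2 Shimura's `X_f` are closed: the endomorphism loci `X_M = {Z : ρ(M) ∈ End(X_Z)}` are closed** in
  `𝔥_g` and in `𝔥_g ∩ 𝔜_j` (zero sets of the matrix polynomials `(Zβ + δ)Z − Zα − γ`: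
  `isClosed_setOf_mulVec_latticeJ_comm`, `isClosed_locus_setOf_mulVec_latticeJ_comm`).
* **§3 `𝔜_j` is a Baire space**: `{Z : jZ = −Z̄j}` is closed, `𝔥_g ∩ 𝔜_j` is locally closed in `M_g(ℂ)`,
  hence locally compact, hence Baire (`isLocallyClosed_locus`, `locallyCompactSpace_locus`,
  `baireSpace_locus`).
* **§4 Prop. 10 + Prop. 12 at every point of `𝔜_j` with `End(X_Z) = ℤ`**
  (`isPolarizedIso_conj_and_isEmpty_realStructure_of_locus_of_end_eq_smul_one`: the package g49-#1 proved at
  sweep points only, now for ANY `Z ∈ 𝔥_g ∩ 𝔜_j` with `End = ℤ`).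
* **§5 «`X_f` … contains no non-empty open subset of `𝔜`»**: for a NON-SCALAR integral `M` the complement
  of `X_M` is open and dense in `𝔥_g ∩ 𝔜_j` (`isOpen_locus_setOf_not_mulVec_latticeJ_comm`,
  `dense_locus_setOf_not_mulVec_latticeJ_comm` — density from g49-#7: every open set of the locus holds a
  point with `End = ℤ`, at which `ρ(M) ∉ End`).
* **§6 «Since `S′` is a countable set, `𝔜` cannot be covered by `∪ X_f`»: THE GENERIC POINTS ARE RESIDUAL**
  in `𝔥_g ∩ 𝔜_j` (`eventually_residual_locus_generic`: they contain `⋂_{M non-scalar} X_Mᶜ`, a countable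
  intersection of open dense sets), hence dense (`dense_locus_generic`, g49-#7 recovered through Baire),
  and for every countable family of closed subsets of `𝔥_g ∩ 𝔜_j` with empty interiors there are generic
  points outside all of them — a dense set of them (`dense_locus_generic_diff_iUnion`,
  `exists_locus_generic_not_mem_iUnion`, the literal «`𝔜` cannot be covered by `∪_{f ∈ S′} X_f`.
  Therefore `𝔜` has a point `z` for which `f(φ(z)) ≠ 0` for all `f ∈ S′`»).
-/

noncomputable section

open scoped Manifold Matrix ComplexConjugate Topology
open Matrix Complex Function Set Filter

namespace Literature.AlgebraicGeometry.ModuliOfAbelianVarieties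

namespace SiegelModuli

open Literature.NumberTheory.Automorphic (siegelUpperHalfSpace)
open Literature.NumberTheory.ModularForms.SiegelUpperHalfSpace (isOpen_setOf_im_pos siegelUpperHalfSpace_eq_inter
  isLocallyClosed_siegelUpperHalfSpace)
open Literature.Geometry.Kaehler Literature.Geometry.Kaehler.ComplexTorus

variable {g : ℕ}

/-! ## §1 `End(X_Z)` in blocks, both ways: `ρ(α β; γ δ)` is holomorphic iff `(Zβ + δ)Z = Zα + γ` -/

section Blocks

variable (hδ : ∀ i, 0 < (1 : Fin g → ℕ) i) {Z : Matrix (Fin g) (Fin g) ℂ}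
  (hZ : Z ∈ siegelUpperHalfSpace g)

/-- **The period relation suffices**: if integral blocks satisfy `(Zβ + δ)Z = Zα + γ`, then
`M = (α β; γ δ)` commutes with the complex structure `J_Z` of `X_Z = ℂ^g/(Z, 1)ℤ^{2g}` (its analytic
representation is the `ℂ`-linear map `Zβ + δ`: «`A(Z′, D) = (Z, D)R`» read backwards), i.e. `ρ(M)` is a
holomorphic endomorphism of `X_Z` (the converse of g48-#3 `exists_blocks_rel_of_mulVec_latticeJ`).
[cite: Lange2023AbelianVarietiesComplex, §1.1.2 Prop. 1.1.6 and (1.2), pp. 19–20; §3.1.2 Prop. 3.1.4, pp. 158–160] -/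
theorem mulVec_latticeJ_comm_of_blocks_rel (α β γ δ : Matrix (Fin g) (Fin g) ℤ)
    (hrel : (Z * β.map (Int.cast : ℤ → ℂ) + δ.map (Int.cast : ℤ → ℂ)) * Z =
      Z * α.map (Int.cast : ℤ → ℂ) + γ.map (Int.cast : ℤ → ℂ)) :
    ∀ x, ((Matrix.fromBlocks α β γ δ).map (Int.cast : ℤ → ℝ)) *ᵥ latticeJ (siegelPeriodEquiv hδ hZ) x =
      latticeJ (siegelPeriodEquiv hδ hZ) (((Matrix.fromBlocks α β γ δ).map (Int.cast : ℤ → ℝ)) *ᵥ x) := by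
  intro x
  set C : (Fin g → ℂ) →ₗ[ℂ] (Fin g → ℂ) :=
    Matrix.toLin' (Z * β.map (Int.cast : ℤ → ℂ) + δ.map (Int.cast : ℤ → ℂ)) with hC
  have hmat : LinearMap.toMatrix' C * siegelPeriodMatrix (1 : Fin g → ℕ) Z =
      siegelPeriodMatrix (1 : Fin g → ℕ) Z * (Matrix.fromBlocks α β γ δ).map (Int.cast : ℤ → ℂ) := by
    rw [hC, LinearMap.toMatrix'_toLin']
    exact (mul_siegelPeriodMatrix_eq_mul_fromBlocks_iff₄ α β γ δ _ Z Z).2 ⟨hrel, rfl⟩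
  have hCΦ : ∀ v, C (siegelPeriodEquiv hδ hZ v) =
      siegelPeriodEquiv hδ hZ (((Matrix.fromBlocks α β γ δ).map (Int.cast : ℤ → ℝ)) *ᵥ v) := fun v ↦ by
    rw [siegelPeriodEquiv_apply, siegelPeriodEquiv_apply]
    exact (rel_iff_matrix (1 : Fin g → ℕ) Z Z C (Matrix.fromBlocks α β γ δ)).2 hmat v
  apply (siegelPeriodEquiv hδ hZ).injective
  rw [apply_latticeJ, ← hCΦ, ← hCΦ, apply_latticeJ, map_smul]

/-- **`End(X_Z)` in blocks, both ways**: an integral `2g × 2g` matrix `M` commutes with `J_Z` (is a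
holomorphic endomorphism `ρ(M)` of `X_Z`) iff its blocks `α = M₁₁`, `β = M₁₂`, `γ = M₂₁`, `δ = M₂₂` satisfy
the period relation **`(Zβ + δ)Z = Zα + γ`**. [cite: Lange2023AbelianVarietiesComplex, §1.1.2 Prop. 1.1.6 and (1.2), pp. 19–20; §3.1.2 Prop. 3.1.4, pp. 158–160] -/
theorem mulVec_latticeJ_comm_iff_toBlocks_rel (M : Matrix (Fin g ⊕ Fin g) (Fin g ⊕ Fin g) ℤ) :
    (∀ x, (M.map (Int.cast : ℤ → ℝ)) *ᵥ latticeJ (siegelPeriodEquiv hδ hZ) x =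
        latticeJ (siegelPeriodEquiv hδ hZ) ((M.map (Int.cast : ℤ → ℝ)) *ᵥ x)) ↔
      (Z * M.toBlocks₁₂.map (Int.cast : ℤ → ℂ) + M.toBlocks₂₂.map (Int.cast : ℤ → ℂ)) * Z =
        Z * M.toBlocks₁₁.map (Int.cast : ℤ → ℂ) + M.toBlocks₂₁.map (Int.cast : ℤ → ℂ) := by
  constructor
  · intro hM
    obtain ⟨α, β, γ, δ, hMb, hrel⟩ := exists_blocks_rel_of_mulVec_latticeJ hδ hZ hM
    rw [hMb, Matrix.toBlocks_fromBlocks₁₁, Matrix.toBlocks_fromBlocks₁₂, Matrix.toBlocks_fromBlocks₂₁,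
      Matrix.toBlocks_fromBlocks₂₂]
    exact hrel
  · intro hrel
    have h := mulVec_latticeJ_comm_of_blocks_rel hδ hZ M.toBlocks₁₁ M.toBlocks₁₂ M.toBlocks₂₁ M.toBlocks₂₂ hrel
    rwa [Matrix.fromBlocks_toBlocks] at h

end Blocks

/-! ## §2 Shimura's `X_f` are closed: the endomorphism locus of a fixed integral `M` is closed in `𝔥_g` and
in `𝔥_g ∩ 𝔜_j` -/

section Closed

variable (hδ : ∀ i, 0 < (1 : Fin g → ℕ) i)

/-- The matrix polynomial `Z ↦ (Zβ + δ)Z` is continuous. [folklore] -/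
private theorem continuous_rel_lhs_g50a (β δ : Matrix (Fin g) (Fin g) ℤ) :
    Continuous fun Z : Matrix (Fin g) (Fin g) ℂ ↦
      (Z * β.map (Int.cast : ℤ → ℂ) + δ.map (Int.cast : ℤ → ℂ)) * Z :=
  ((continuous_id.matrix_mul continuous_const).add continuous_const).matrix_mul continuous_id

/-- The matrix polynomial `Z ↦ Zα + γ` is continuous. [folklore] -/
private theorem continuous_rel_rhs_g50a (α γ : Matrix (Fin g) (Fin g) ℤ) :
    Continuous fun Z : Matrix (Fin g) (Fin g) ℂ ↦ Z * α.map (Int.cast : ℤ → ℂ) + γ.map (Int.cast : ℤ → ℂ) :=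
  (continuous_id.matrix_mul continuous_const).add continuous_const

/-- **The endomorphism locus `X_M = {Z ∈ 𝔥_g : ρ(M) ∈ End(X_Z)}` of a fixed integral `M` is closed in
`𝔥_g`** — it is the zero set of the matrix polynomial `(Zβ + δ)Z − Zα − γ` (§1) («`X_f` is a closed
subset»). [cite: Shimura1972FieldOfRationality, §3 Thm. 2 proof («`X_f` is a closed subset of `𝔜`»), p. 177] [cite: Lange2023AbelianVarietiesComplex, §1.1.2 (1.2), p. 20] -/
theorem isClosed_setOf_mulVec_latticeJ_comm (M : Matrix (Fin g ⊕ Fin g) (Fin g ⊕ Fin g) ℤ) :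
    IsClosed {z : siegelUpperHalfSpace g | ∀ x, (M.map (Int.cast : ℤ → ℝ)) *ᵥ latticeJ (siegelPeriodEquiv hδ z.2) x =
      latticeJ (siegelPeriodEquiv hδ z.2) ((M.map (Int.cast : ℤ → ℝ)) *ᵥ x)} := by
  have hset : {z : siegelUpperHalfSpace g | ∀ x, (M.map (Int.cast : ℤ → ℝ)) *ᵥ latticeJ (siegelPeriodEquiv hδ z.2) x =
      latticeJ (siegelPeriodEquiv hδ z.2) ((M.map (Int.cast : ℤ → ℝ)) *ᵥ x)} =
      Subtype.val ⁻¹' {Z : Matrix (Fin g) (Fin g) ℂ |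
        (Z * M.toBlocks₁₂.map (Int.cast : ℤ → ℂ) + M.toBlocks₂₂.map (Int.cast : ℤ → ℂ)) * Z =
          Z * M.toBlocks₁₁.map (Int.cast : ℤ → ℂ) + M.toBlocks₂₁.map (Int.cast : ℤ → ℂ)} := by
    ext z
    simp only [Set.mem_setOf_eq, Set.mem_preimage]
    exact mulVec_latticeJ_comm_iff_toBlocks_rel hδ z.2 M
  rw [hset]
  exact (isClosed_eq (continuous_rel_lhs_g50a _ _) (continuous_rel_rhs_g50a _ _)).preimage
    continuous_subtype_val

variable (j : Matrix (Fin g) (Fin g) ℤ)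

/-- **Shimura's `X_f` on the locus: `X_M = {Z ∈ 𝔥_g ∩ 𝔜_j : ρ(M) ∈ End(X_Z)}` is closed in `𝔥_g ∩ 𝔜_j`**
for every integral `M` («Then `X_f` is a closed subset of `𝔜`»). [cite: Shimura1972FieldOfRationality, §3 Thm. 2 proof, p. 177] -/
theorem isClosed_locus_setOf_mulVec_latticeJ_comm (M : Matrix (Fin g ⊕ Fin g) (Fin g ⊕ Fin g) ℤ) :
    IsClosed {z : ↥(siegelUpperHalfSpace g ∩
        {Z : Matrix (Fin g) (Fin g) ℂ | j.map (Int.cast : ℤ → ℂ) * Z = -Z.map conj * j.map (Int.cast : ℤ → ℂ)}) |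
      ∀ x, (M.map (Int.cast : ℤ → ℝ)) *ᵥ latticeJ (siegelPeriodEquiv hδ z.2.1) x =
        latticeJ (siegelPeriodEquiv hδ z.2.1) ((M.map (Int.cast : ℤ → ℝ)) *ᵥ x)} := by
  have hset : {z : ↥(siegelUpperHalfSpace g ∩
        {Z : Matrix (Fin g) (Fin g) ℂ | j.map (Int.cast : ℤ → ℂ) * Z = -Z.map conj * j.map (Int.cast : ℤ → ℂ)}) |
      ∀ x, (M.map (Int.cast : ℤ → ℝ)) *ᵥ latticeJ (siegelPeriodEquiv hδ z.2.1) x =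
        latticeJ (siegelPeriodEquiv hδ z.2.1) ((M.map (Int.cast : ℤ → ℝ)) *ᵥ x)} =
      Subtype.val ⁻¹' {Z : Matrix (Fin g) (Fin g) ℂ |
        (Z * M.toBlocks₁₂.map (Int.cast : ℤ → ℂ) + M.toBlocks₂₂.map (Int.cast : ℤ → ℂ)) * Z =
          Z * M.toBlocks₁₁.map (Int.cast : ℤ → ℂ) + M.toBlocks₂₁.map (Int.cast : ℤ → ℂ)} := by
    ext z
    simp only [Set.mem_setOf_eq, Set.mem_preimage]
    exact mulVec_latticeJ_comm_iff_toBlocks_rel hδ z.2.1 M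
  rw [hset]
  exact (isClosed_eq (continuous_rel_lhs_g50a _ _) (continuous_rel_rhs_g50a _ _)).preimage
    continuous_subtype_val

end Closed

/-! ## §3 `𝔥_g ∩ 𝔜_j` is locally closed in `M_g(ℂ)`, locally compact, a Baire space -/

section Baire

variable (j : Matrix (Fin g) (Fin g) ℤ)

/-- The real-linear condition `jZ = −Z̄j` cuts out a closed subset of `M_g(ℂ)`. [cite: Shimura1972FieldOfRationality, §3 Prop. 10–11 (the set `𝔜`), pp. 174–176] -/
theorem isClosed_setOf_locusRel :
    IsClosed {Z : Matrix (Fin g) (Fin g) ℂ | j.map (Int.cast : ℤ → ℂ) * Z = -Z.map conj * j.map (Int.cast : ℤ → ℂ)} :=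
  isClosed_eq (continuous_const.matrix_mul continuous_id)
    ((continuous_id.matrix_map Complex.continuous_conj).neg.matrix_mul continuous_const)

/-- **`𝔥_g ∩ 𝔜_j` is locally closed in `M_g(ℂ)`** (`𝔥_g` is open in the symmetric matrices, `𝔜_j` is a
closed real-linear condition). [cite: Shimura1972FieldOfRationality, §3 Prop. 11 (the real coordinates of `𝔜`), pp. 175–176] -/
theorem isLocallyClosed_locus :
    IsLocallyClosed (siegelUpperHalfSpace g ∩
      {Z : Matrix (Fin g) (Fin g) ℂ | j.map (Int.cast : ℤ → ℂ) * Z = -Z.map conj * j.map (Int.cast : ℤ → ℂ)}) :=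
  isLocallyClosed_siegelUpperHalfSpace.inter (isClosed_setOf_locusRel j).isLocallyClosed

/-- **`𝔥_g ∩ 𝔜_j` is locally compact** (a locally closed subset of the finite-dimensional space `M_g(ℂ)`).
[cite: Shimura1972FieldOfRationality, §3 Prop. 11, pp. 175–176] -/
theorem locallyCompactSpace_locus :
    LocallyCompactSpace ↥(siegelUpperHalfSpace g ∩
      {Z : Matrix (Fin g) (Fin g) ℂ | j.map (Int.cast : ℤ → ℂ) * Z = -Z.map conj * j.map (Int.cast : ℤ → ℂ)}) := by
  haveI : LocallyCompactSpace (Matrix (Fin g) (Fin g) ℂ) :=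
    inferInstanceAs (LocallyCompactSpace (Fin g → Fin g → ℂ))
  exact (isLocallyClosed_locus j).locallyCompactSpace

/-- **`𝔥_g ∩ 𝔜_j` is a Baire space** (locally compact Hausdorff) — the topological fact behind «Since `S′`
is a countable set, `𝔜` cannot be covered by `∪_{f ∈ S′} X_f`». [cite: Shimura1972FieldOfRationality, §3 Thm. 2 proof, p. 177] -/
theorem baireSpace_locus :
    BaireSpace ↥(siegelUpperHalfSpace g ∩
      {Z : Matrix (Fin g) (Fin g) ℂ | j.map (Int.cast : ℤ → ℂ) * Z = -Z.map conj * j.map (Int.cast : ℤ → ℂ)}) := by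
  haveI := locallyCompactSpace_locus j
  exact BaireSpace.of_t2Space_locallyCompactSpace

end Baire

/-! ## §4 Prop. 10 + Prop. 12 at EVERY point of `𝔜_j` with `End(X_Z) = ℤ` -/

section Package

variable (hδ : ∀ i, 0 < (1 : Fin g → ℕ) i) {j : Matrix (Fin g) (Fin g) ℤ} {Z : Matrix (Fin g) (Fin g) ℂ}
  (hZ𝔥 : Z ∈ siegelUpperHalfSpace g)

/-- `End(X_Z) = ℤ` forces `End(X_Z)^* = {±1}`: a holomorphic `ρ(P)` with `P` invertible over `ℤ` is `±1`
(the hypothesis of Prop. 12). [cite: Shimura1972FieldOfRationality, §3 Prop. 12 (hypothesis «no automorphisms other than `±1`»), p. 176] -/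
theorem end_units_of_end_eq_smul_one (hg : 0 < g)
    (hEnd : ∀ M : Matrix (Fin g ⊕ Fin g) (Fin g ⊕ Fin g) ℤ,
      (∀ x, (M.map (Int.cast : ℤ → ℝ)) *ᵥ latticeJ (siegelPeriodEquiv hδ hZ𝔥) x =
        latticeJ (siegelPeriodEquiv hδ hZ𝔥) ((M.map (Int.cast : ℤ → ℝ)) *ᵥ x)) → ∃ c : ℤ, M = c • 1)
    (P : Matrix (Fin g ⊕ Fin g) (Fin g ⊕ Fin g) ℤ)
    (hP : MDifferentiable 𝓘(ℂ, Fin g → ℂ) 𝓘(ℂ, Fin g → ℂ)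
      (mapMatrix (siegelPeriodEquiv hδ hZ𝔥) (siegelPeriodEquiv hδ hZ𝔥) P))
    (hPQ : ∃ Q : Matrix (Fin g ⊕ Fin g) (Fin g ⊕ Fin g) ℤ, P * Q = 1 ∧ Q * P = 1) :
    P = 1 ∨ P = -1 := by
  obtain ⟨Q, hPQ, -⟩ := hPQ
  obtain ⟨c, hc⟩ := hEnd P (mulVec_latticeJ_comm_of_mdifferentiable hP)
  rw [hc, Matrix.smul_mul, Matrix.one_mul] at hPQ
  set i₀ : Fin g ⊕ Fin g := Sum.inl ⟨0, hg⟩ with hi₀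
  have hcq : c * Q i₀ i₀ = 1 := by
    have e := congrFun (congrFun hPQ i₀) i₀
    simpa using e
  rcases Int.eq_one_or_neg_one_of_mul_eq_one hcq with h1 | h1
  · left
    rw [hc, h1, one_smul]
  · right
    rw [hc, h1, neg_smul, one_smul]

/-- **Prop. 10 + Prop. 12 at every point of `𝔜_j` with `End(X_Z) = ℤ`.**  For an integral `j` with
`j² = −1`, `ᵗj = −j` (`g ≥ 1`) and `Z ∈ 𝔥_g` with `jZ = −Z̄j` whose torus has `End(X_Z) = ℤ`: `(X_Z, E_Z)`
is isomorphic to its conjugate `(X_{−Z̄}, E_{−Z̄})` as a principally polarized torus (Prop. 10,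
`λ = ρ(j ⊕ j)`), `X_Z` is isomorphic as a complex torus to EVERY conjugate presentation, and `X_Z` admits
NO real structure (Prop. 12: «`P_z` has no model rational over its field of moduli»).  g49-#1 proved this
package at the sweep points with algebraically independent parameters; the hypothesis actually used is
`End(X_Z) = ℤ`. [cite: Shimura1972FieldOfRationality, §3 Prop. 10 and Prop. 12, pp. 174–176] [cite: Silhol1989, Ch. IV §4 («an example due to Shimura»), p. 58] -/
theorem isPolarizedIso_conj_and_isEmpty_realStructure_of_locus_of_end_eq_smul_one (hg : 0 < g)
    (hjj : j * j = -1) (hjT : jᵀ = -j)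
    (hjZ : j.map (Int.cast : ℤ → ℂ) * Z = -Z.map conj * j.map (Int.cast : ℤ → ℂ))
    (hEnd : ∀ M : Matrix (Fin g ⊕ Fin g) (Fin g ⊕ Fin g) ℤ,
      (∀ x, (M.map (Int.cast : ℤ → ℝ)) *ᵥ latticeJ (siegelPeriodEquiv hδ hZ𝔥) x =
        latticeJ (siegelPeriodEquiv hδ hZ𝔥) ((M.map (Int.cast : ℤ → ℝ)) *ᵥ x)) → ∃ c : ℤ, M = c • 1) :
    (∃ h : ComplexTorus (siegelPeriodEquiv hδ hZ𝔥) ≃+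
        ComplexTorus (siegelPeriodEquiv hδ (neg_map_conj_mem_siegelUpperHalfSpace hZ𝔥)),
      IsPolarizedIso (siegelPeriodEquiv hδ hZ𝔥) (siegelForm hδ hZ𝔥)
        (siegelPeriodEquiv hδ (neg_map_conj_mem_siegelUpperHalfSpace hZ𝔥))
        (siegelForm hδ (neg_map_conj_mem_siegelUpperHalfSpace hZ𝔥)) h) ∧
    (∀ {Ec : Type} [NormedAddCommGroup Ec] [NormedSpace ℂ Ec] (Ψc : (Fin g ⊕ Fin g → ℝ) ≃L[ℝ] Ec),
        (∀ w, latticeJ Ψc w = -latticeJ (siegelPeriodEquiv hδ hZ𝔥) w) →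
          IsIsomorphic (siegelPeriodEquiv hδ hZ𝔥) Ψc) ∧
    IsEmpty (RealStructure 𝓘(ℂ, Fin g → ℂ) (ComplexTorus (siegelPeriodEquiv hδ hZ𝔥))) := by
  have hjT1 : jᵀ * j = 1 := transpose_mul_self_eq_one_of_locusJ hjj hjT
  obtain ⟨h, hh, -, -⟩ := exists_isPolarizedIso_blockDiag hδ hZ𝔥 (neg_map_conj_mem_siegelUpperHalfSpace hZ𝔥) j
    hjT1 hjZ
  obtain ⟨hiso, hempty⟩ := isIsomorphic_conj_and_isEmpty_realStructure_of_blockRel hδ hZ𝔥 j hg hjj hjZ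
    (end_units_of_end_eq_smul_one hδ hZ𝔥 hg hEnd)
  exact ⟨⟨h, hh⟩, hiso, hempty⟩

end Package

/-! ## §5 «`X_f` … contains no non-empty open subset of `𝔜`»: for a non-scalar `M` the complement of `X_M`
is open and dense in `𝔥_g ∩ 𝔜_j` -/

section OpenDense

variable (hδ : ∀ i, 0 < (1 : Fin g → ℕ) i) (j : Matrix (Fin g) (Fin g) ℤ)

/-- The complement of `X_M` in `𝔥_g ∩ 𝔜_j` is open (§2). [cite: Shimura1972FieldOfRationality, §3 Thm. 2 proof («`X_f` is a closed subset of `𝔜`»), p. 177] -/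
theorem isOpen_locus_setOf_not_mulVec_latticeJ_comm (M : Matrix (Fin g ⊕ Fin g) (Fin g ⊕ Fin g) ℤ) :
    IsOpen {z : ↥(siegelUpperHalfSpace g ∩
        {Z : Matrix (Fin g) (Fin g) ℂ | j.map (Int.cast : ℤ → ℂ) * Z = -Z.map conj * j.map (Int.cast : ℤ → ℂ)}) |
      ¬ ∀ x, (M.map (Int.cast : ℤ → ℝ)) *ᵥ latticeJ (siegelPeriodEquiv hδ z.2.1) x =
        latticeJ (siegelPeriodEquiv hδ z.2.1) ((M.map (Int.cast : ℤ → ℝ)) *ᵥ x)} :=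
  (isClosed_locus_setOf_mulVec_latticeJ_comm hδ j M).isOpen_compl

variable {j}

/-- **«`X_f` … contains no non-empty open subset of `𝔜`»: for a NON-SCALAR integral `M`, the points of
`𝔥_g ∩ 𝔜_j` at which `ρ(M)` is NOT an endomorphism are dense in `𝔥_g ∩ 𝔜_j`** (`j² = −1`, `ᵗj = −j`,
`g ≥ 1`) — every non-empty open subset of the locus contains a point with `End(X_Z) = ℤ` (g49-#7), where a
non-scalar `M` is not an endomorphism. [cite: Shimura1972FieldOfRationality, §3 Prop. 11 and Thm. 2 proof, pp. 175–177] -/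
theorem dense_locus_setOf_not_mulVec_latticeJ_comm (hg : 0 < g) (hjj : j * j = -1) (hjT : jᵀ = -j)
    {M : Matrix (Fin g ⊕ Fin g) (Fin g ⊕ Fin g) ℤ} (hM : ∀ c : ℤ, M ≠ c • 1) :
    Dense {z : ↥(siegelUpperHalfSpace g ∩
        {Z : Matrix (Fin g) (Fin g) ℂ | j.map (Int.cast : ℤ → ℂ) * Z = -Z.map conj * j.map (Int.cast : ℤ → ℂ)}) |
      ¬ ∀ x, (M.map (Int.cast : ℤ → ℝ)) *ᵥ latticeJ (siegelPeriodEquiv hδ z.2.1) x =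
        latticeJ (siegelPeriodEquiv hδ z.2.1) ((M.map (Int.cast : ℤ → ℝ)) *ᵥ x)} := by
  intro z₀
  rw [closure_subtype]
  refine closure_mono ?_ (locus_subset_closure_generic hδ hg hjj hjT z₀.2)
  rintro Z ⟨hZ𝔥, hjZ, -, hend, -⟩
  refine ⟨⟨Z, hZ𝔥, hjZ⟩, fun hcomm ↦ ?_, rfl⟩
  obtain ⟨c, hc⟩ := hend M hcomm
  exact hM c hc

end OpenDense

/-! ## §6 «Since `S′` is a countable set, `𝔜` cannot be covered by `∪_{f ∈ S′} X_f`»: the generic points are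
RESIDUAL in `𝔥_g ∩ 𝔜_j` -/

section Residual

variable (hδ : ∀ i, 0 < (1 : Fin g → ℕ) i) {j : Matrix (Fin g) (Fin g) ℤ}

/-- **THEOREM 2 IN BAIRE-CATEGORY FORM ON THE LOCUS.**  For every integral `j` with `j² = −1`, `ᵗj = −j`
(`g ≥ 1`), the points `Z` of `𝔥_g ∩ 𝔜_j` whose principally polarized torus `(X_Z, E_Z)` is isomorphic to
its conjugate `(X_{−Z̄}, E_{−Z̄})`, is isomorphic as a complex torus to every conjugate presentation, has
`End(X_Z) = ℤ`, and admits NO real structure, form a RESIDUAL (comeagre) subset of `𝔥_g ∩ 𝔜_j`: they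
contain the countable intersection `⋂_{M ∉ ℤ·1} X_Mᶜ` of open dense subsets («`X_f` is a closed subset of
`𝔜`, which contains no non-empty open subset of `𝔜` … Since `S′` is a countable set, `𝔜` cannot be
covered by `∪_{f ∈ S′} X_f`»). [cite: Shimura1972FieldOfRationality, §3 Prop. 10–12 and Thm. 2 with its proof, pp. 174–177] -/
theorem eventually_residual_locus_generic (hg : 0 < g) (hjj : j * j = -1) (hjT : jᵀ = -j) :
    ∀ᶠ z in residual ↥(siegelUpperHalfSpace g ∩
        {Z : Matrix (Fin g) (Fin g) ℂ | j.map (Int.cast : ℤ → ℂ) * Z = -Z.map conj * j.map (Int.cast : ℤ → ℂ)}),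
      (∃ h : ComplexTorus (siegelPeriodEquiv hδ z.2.1) ≃+
          ComplexTorus (siegelPeriodEquiv hδ (neg_map_conj_mem_siegelUpperHalfSpace z.2.1)),
        IsPolarizedIso (siegelPeriodEquiv hδ z.2.1) (siegelForm hδ z.2.1)
          (siegelPeriodEquiv hδ (neg_map_conj_mem_siegelUpperHalfSpace z.2.1))
          (siegelForm hδ (neg_map_conj_mem_siegelUpperHalfSpace z.2.1)) h) ∧
      (∀ {Ec : Type} [NormedAddCommGroup Ec] [NormedSpace ℂ Ec] (Ψc : (Fin g ⊕ Fin g → ℝ) ≃L[ℝ] Ec),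
          (∀ w, latticeJ Ψc w = -latticeJ (siegelPeriodEquiv hδ z.2.1) w) →
            IsIsomorphic (siegelPeriodEquiv hδ z.2.1) Ψc) ∧
      (∀ M : Matrix (Fin g ⊕ Fin g) (Fin g ⊕ Fin g) ℤ,
          (∀ x, (M.map (Int.cast : ℤ → ℝ)) *ᵥ latticeJ (siegelPeriodEquiv hδ z.2.1) x =
            latticeJ (siegelPeriodEquiv hδ z.2.1) ((M.map (Int.cast : ℤ → ℝ)) *ᵥ x)) → ∃ c : ℤ, M = c • 1) ∧
      IsEmpty (RealStructure 𝓘(ℂ, Fin g → ℂ) (ComplexTorus (siegelPeriodEquiv hδ z.2.1))) := by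
  haveI : Countable (Matrix (Fin g ⊕ Fin g) (Fin g ⊕ Fin g) ℤ) :=
    inferInstanceAs (Countable (Fin g ⊕ Fin g → Fin g ⊕ Fin g → ℤ))
  -- the countable family of non-scalar integral matrices and the residual set `⋂ X_Mᶜ`
  have hS : {M : Matrix (Fin g ⊕ Fin g) (Fin g ⊕ Fin g) ℤ | ∀ c : ℤ, M ≠ c • 1}.Countable := Set.to_countable _
  have hres : (⋂ M ∈ {M : Matrix (Fin g ⊕ Fin g) (Fin g ⊕ Fin g) ℤ | ∀ c : ℤ, M ≠ c • 1},
      {z : ↥(siegelUpperHalfSpace g ∩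
          {Z : Matrix (Fin g) (Fin g) ℂ | j.map (Int.cast : ℤ → ℂ) * Z = -Z.map conj * j.map (Int.cast : ℤ → ℂ)}) |
        ¬ ∀ x, (M.map (Int.cast : ℤ → ℝ)) *ᵥ latticeJ (siegelPeriodEquiv hδ z.2.1) x =
          latticeJ (siegelPeriodEquiv hδ z.2.1) ((M.map (Int.cast : ℤ → ℝ)) *ᵥ x)}) ∈
      residual ↥(siegelUpperHalfSpace g ∩
        {Z : Matrix (Fin g) (Fin g) ℂ | j.map (Int.cast : ℤ → ℂ) * Z = -Z.map conj * j.map (Int.cast : ℤ → ℂ)}) :=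
    (countable_bInter_mem hS).2 fun M hM ↦ residual_of_dense_open
      (isOpen_locus_setOf_not_mulVec_latticeJ_comm hδ j M)
      (dense_locus_setOf_not_mulVec_latticeJ_comm hδ hg hjj hjT hM)
  refine Filter.mem_of_superset hres fun z hz ↦ ?_
  -- off every `X_M`, `M ∉ ℤ·1`: `End(X_Z) = ℤ`
  have hEnd : ∀ M : Matrix (Fin g ⊕ Fin g) (Fin g ⊕ Fin g) ℤ,
      (∀ x, (M.map (Int.cast : ℤ → ℝ)) *ᵥ latticeJ (siegelPeriodEquiv hδ z.2.1) x =
        latticeJ (siegelPeriodEquiv hδ z.2.1) ((M.map (Int.cast : ℤ → ℝ)) *ᵥ x)) → ∃ c : ℤ, M = c • 1 := by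
    intro M hcomm
    by_contra hne
    push Not at hne
    exact (Set.mem_iInter₂.1 hz M hne) hcomm
  obtain ⟨hpol, hiso, hempty⟩ :=
    isPolarizedIso_conj_and_isEmpty_realStructure_of_locus_of_end_eq_smul_one hδ z.2.1 hg hjj hjT z.2.2 hEnd
  exact ⟨hpol, hiso, hEnd, hempty⟩

/-- **The generic points are DENSE in `𝔥_g ∩ 𝔜_j`** — g49-#7 `locus_subset_closure_generic` recovered from the
residual form through the Baire property of the locus (§3). [cite: Shimura1972FieldOfRationality, §3 Prop. 11 and Thm. 2, pp. 175–177] -/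
theorem dense_locus_generic (hg : 0 < g) (hjj : j * j = -1) (hjT : jᵀ = -j) :
    Dense {z : ↥(siegelUpperHalfSpace g ∩
        {Z : Matrix (Fin g) (Fin g) ℂ | j.map (Int.cast : ℤ → ℂ) * Z = -Z.map conj * j.map (Int.cast : ℤ → ℂ)}) |
      (∃ h : ComplexTorus (siegelPeriodEquiv hδ z.2.1) ≃+
          ComplexTorus (siegelPeriodEquiv hδ (neg_map_conj_mem_siegelUpperHalfSpace z.2.1)),
        IsPolarizedIso (siegelPeriodEquiv hδ z.2.1) (siegelForm hδ z.2.1)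
          (siegelPeriodEquiv hδ (neg_map_conj_mem_siegelUpperHalfSpace z.2.1))
          (siegelForm hδ (neg_map_conj_mem_siegelUpperHalfSpace z.2.1)) h) ∧
      (∀ {Ec : Type} [NormedAddCommGroup Ec] [NormedSpace ℂ Ec] (Ψc : (Fin g ⊕ Fin g → ℝ) ≃L[ℝ] Ec),
          (∀ w, latticeJ Ψc w = -latticeJ (siegelPeriodEquiv hδ z.2.1) w) →
            IsIsomorphic (siegelPeriodEquiv hδ z.2.1) Ψc) ∧
      (∀ M : Matrix (Fin g ⊕ Fin g) (Fin g ⊕ Fin g) ℤ,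
          (∀ x, (M.map (Int.cast : ℤ → ℝ)) *ᵥ latticeJ (siegelPeriodEquiv hδ z.2.1) x =
            latticeJ (siegelPeriodEquiv hδ z.2.1) ((M.map (Int.cast : ℤ → ℝ)) *ᵥ x)) → ∃ c : ℤ, M = c • 1) ∧
      IsEmpty (RealStructure 𝓘(ℂ, Fin g → ℂ) (ComplexTorus (siegelPeriodEquiv hδ z.2.1)))} := by
  haveI := baireSpace_locus j
  exact dense_of_mem_residual (eventually_residual_locus_generic hδ hg hjj hjT)

/-- **«`𝔜` cannot be covered by `∪_{f ∈ S′} X_f`», with the generic conclusion**: for every countable family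
`X_n` of closed subsets of `𝔥_g ∩ 𝔜_j` with empty interiors («`X_f` is a closed subset of `𝔜`, which
contains no non-empty open subset of `𝔜`»), the generic points of `𝔥_g ∩ 𝔜_j` (polarized-isomorphic to
the conjugate, isomorphic to every conjugate presentation, `End = ℤ`, no real structure) lying OUTSIDE
`⋃_n X_n` are still dense in `𝔥_g ∩ 𝔜_j`. [cite: Shimura1972FieldOfRationality, §3 Thm. 2 proof, p. 177] -/
theorem dense_locus_generic_diff_iUnion (hg : 0 < g) (hjj : j * j = -1) (hjT : jᵀ = -j)
    {ι : Type*} [Countable ι]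
    (X : ι → Set ↥(siegelUpperHalfSpace g ∩
      {Z : Matrix (Fin g) (Fin g) ℂ | j.map (Int.cast : ℤ → ℂ) * Z = -Z.map conj * j.map (Int.cast : ℤ → ℂ)}))
    (hXc : ∀ n, IsClosed (X n)) (hXi : ∀ n, interior (X n) = ∅) :
    Dense ({z : ↥(siegelUpperHalfSpace g ∩
        {Z : Matrix (Fin g) (Fin g) ℂ | j.map (Int.cast : ℤ → ℂ) * Z = -Z.map conj * j.map (Int.cast : ℤ → ℂ)}) |
      (∃ h : ComplexTorus (siegelPeriodEquiv hδ z.2.1) ≃+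
          ComplexTorus (siegelPeriodEquiv hδ (neg_map_conj_mem_siegelUpperHalfSpace z.2.1)),
        IsPolarizedIso (siegelPeriodEquiv hδ z.2.1) (siegelForm hδ z.2.1)
          (siegelPeriodEquiv hδ (neg_map_conj_mem_siegelUpperHalfSpace z.2.1))
          (siegelForm hδ (neg_map_conj_mem_siegelUpperHalfSpace z.2.1)) h) ∧
      (∀ {Ec : Type} [NormedAddCommGroup Ec] [NormedSpace ℂ Ec] (Ψc : (Fin g ⊕ Fin g → ℝ) ≃L[ℝ] Ec),
          (∀ w, latticeJ Ψc w = -latticeJ (siegelPeriodEquiv hδ z.2.1) w) →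
            IsIsomorphic (siegelPeriodEquiv hδ z.2.1) Ψc) ∧
      (∀ M : Matrix (Fin g ⊕ Fin g) (Fin g ⊕ Fin g) ℤ,
          (∀ x, (M.map (Int.cast : ℤ → ℝ)) *ᵥ latticeJ (siegelPeriodEquiv hδ z.2.1) x =
            latticeJ (siegelPeriodEquiv hδ z.2.1) ((M.map (Int.cast : ℤ → ℝ)) *ᵥ x)) → ∃ c : ℤ, M = c • 1) ∧
      IsEmpty (RealStructure 𝓘(ℂ, Fin g → ℂ) (ComplexTorus (siegelPeriodEquiv hδ z.2.1)))} \ ⋃ n, X n) := by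
  haveI := baireSpace_locus j
  have hX : (⋃ n, X n)ᶜ ∈ residual ↥(siegelUpperHalfSpace g ∩
      {Z : Matrix (Fin g) (Fin g) ℂ | j.map (Int.cast : ℤ → ℂ) * Z = -Z.map conj * j.map (Int.cast : ℤ → ℂ)}) := by
    rw [Set.compl_iUnion]
    exact countable_iInter_mem.2 fun n ↦
      residual_of_dense_open (hXc n).isOpen_compl (interior_eq_empty_iff_dense_compl.1 (hXi n))
  rw [Set.sdiff_eq]
  exact dense_of_mem_residual (Filter.inter_mem (eventually_residual_locus_generic hδ hg hjj hjT) hX)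

/-- **«Therefore `𝔜` has a point `z` for which `f(φ(z)) ≠ 0` for all `f ∈ S′`»**: for every integral `j`
with `j² = −1`, `ᵗj = −j` (`g ≥ 1`) and every countable family `X_n` of closed subsets of `𝔥_g ∩ 𝔜_j` with
empty interiors, there is a point `Z ∈ 𝔥_g ∩ 𝔜_j` outside all the `X_n` whose principally polarized torus
is isomorphic to its conjugate, has `End(X_Z) = ℤ`, and admits no real structure. [cite: Shimura1972FieldOfRationality, §3 Thm. 2 proof, p. 177] -/
theorem exists_locus_generic_not_mem_iUnion (hg : 0 < g) (hjj : j * j = -1) (hjT : jᵀ = -j)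
    {ι : Type*} [Countable ι]
    (X : ι → Set ↥(siegelUpperHalfSpace g ∩
      {Z : Matrix (Fin g) (Fin g) ℂ | j.map (Int.cast : ℤ → ℂ) * Z = -Z.map conj * j.map (Int.cast : ℤ → ℂ)}))
    (hXc : ∀ n, IsClosed (X n)) (hXi : ∀ n, interior (X n) = ∅) :
    ∃ z : ↥(siegelUpperHalfSpace g ∩
        {Z : Matrix (Fin g) (Fin g) ℂ | j.map (Int.cast : ℤ → ℂ) * Z = -Z.map conj * j.map (Int.cast : ℤ → ℂ)}),
      (∀ n, z ∉ X n) ∧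
      (∃ h : ComplexTorus (siegelPeriodEquiv hδ z.2.1) ≃+
          ComplexTorus (siegelPeriodEquiv hδ (neg_map_conj_mem_siegelUpperHalfSpace z.2.1)),
        IsPolarizedIso (siegelPeriodEquiv hδ z.2.1) (siegelForm hδ z.2.1)
          (siegelPeriodEquiv hδ (neg_map_conj_mem_siegelUpperHalfSpace z.2.1))
          (siegelForm hδ (neg_map_conj_mem_siegelUpperHalfSpace z.2.1)) h) ∧
      (∀ M : Matrix (Fin g ⊕ Fin g) (Fin g ⊕ Fin g) ℤ,
          (∀ x, (M.map (Int.cast : ℤ → ℝ)) *ᵥ latticeJ (siegelPeriodEquiv hδ z.2.1) x =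
            latticeJ (siegelPeriodEquiv hδ z.2.1) ((M.map (Int.cast : ℤ → ℝ)) *ᵥ x)) → ∃ c : ℤ, M = c • 1) ∧
      IsEmpty (RealStructure 𝓘(ℂ, Fin g → ℂ) (ComplexTorus (siegelPeriodEquiv hδ z.2.1))) := by
  haveI : Nonempty ↥(siegelUpperHalfSpace g ∩
      {Z : Matrix (Fin g) (Fin g) ℂ | j.map (Int.cast : ℤ → ℂ) * Z = -Z.map conj * j.map (Int.cast : ℤ → ℂ)}) :=
    (locus_nonempty j hjj hjT).to_subtype
  obtain ⟨z, ⟨hpol, -, hend, hempty⟩, hz⟩ := (dense_locus_generic_diff_iUnion hδ hg hjj hjT X hXc hXi).nonempty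
  refine ⟨z, fun n hn ↦ hz (Set.mem_iUnion.2 ⟨n, hn⟩), hpol, hend, hempty⟩

end Residual

end SiegelModuli

end Literature.AlgebraicGeometry.ModuliOfAbelianVarieties
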